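import Summits.BirchSwinnertonDyer.Rank1Residual.X11b.Three.HeegnerIndexCertificate
import Summits.BirchSwinnertonDyer.Rank1Residual.X11b.QuadraticTorsionOfIrr
import Summits.BirchSwinnertonDyer.Rank1Residual.X11b.BDPRouteRankOneBookkeeping
import HarnessLib

/-!
# X11b, the INDEX-CERT consumer in the census's currency `I_K = [E(K)/tors : ℤ·P̄_K]`:
# `ord_p [E(K) : ℤ·P] = ord_p [E(K)/E(K)_tors : ℤ·P̄]` on X11b over a quadratic `K`, and the S17
# consumer with the certificate `p ∤ [E(K)/tors : ℤ·P̄_K]` (cell `b2b-bsdres`, team `x11b3` = N8/O2,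
# seat p5; sub-target S17b of LEAD DEAL #7 R7-9; police row H29 typed)

HONEST FRAMING (cell `b2b-bsdres`, run/shared/lean/b2b/bsd-rank1-residual/, verbatim in every
file): the goal of the cell is to DELETE the COMBINATION-SHAPED residual classes of the
Birch–Swinnerton-Dyer formula for ALL analytic-rank `≤ 1` elliptic curves over `ℚ` — "full BSD
formula for every rank `≤ 1` curve in class `C`" assembled STRICTLY from published theorems — so
that the rank-`≤ 1` remainder becomes exactly the CONSTRUCTION-SHAPED classes, which are TYPED
(missing-input `Prop`s), NOT attempted. This is not "finishing BSD". Team `x11b3` (X11b, STEP L at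
`3 ∥ N`) is a RESEARCH team; no claim beyond the stated class and atom; X11b and X11 ∧ `r = 1` ∧
`p = 3` stay CONSTRUCTION-SHAPED (REFEREE R6.2); nothing here is booked (the lane books); no
census is read here. THEOREMS ONLY (no definition, no named fact, no `sorry`).

## What this file does

S17 (`Three/HeegnerIndexCertificate.lean`, p254735) takes the Heegner-index certificate in the
currency `p ∤ [E(K) : ℤ·P]` (the FULL index `(AddSubgroup.zmultiples P).index` in `E(K)`). The
census column of record and the height computations behind any such certificate (Miller 2011 §4,
the census-lead's D-a′ design) see only `E(K)/E(K)_tors`: their number is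
`I_K = [E(K)/E(K)_tors : ℤ·P̄]`, `P̄` the image of `P` in the tree's `mordellWeilModTorsion`
(`Literature/NumberTheory/EllipticCurves/MordellWeil.lean`), i.e.
`(AddSubgroup.zmultiples (QuotientAddGroup.mk' (AddCommGroup.torsion E(K)) P)).index`. This file
proves the two currencies have the same `p`-adic valuation on X11b and restates the consumer.

* §1 (abstract; an additive commutative group `A` with torsion subgroup `T`, `π : A → A/T`, ANY
  `P : A`, no rank hypothesis): `[A : ℤP] = [ℤP + T : ℤP] · [A/T : ℤ·π(P)]`
  (`index_zmultiples_eq_relIndex_mul_index_mk`; `ℤP + T = π⁻¹(ℤ·π(P))`), the factor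
  `[ℤP + T : ℤP] = [T : T ∩ ℤP]` divides `#T`; hence if `T` is finite with `p ∤ #T` — in
  particular if `A` has no `p`-torsion — then `p ∣ [A : ℤP] ↔ p ∣ [A/T : ℤ·π(P)]` and
  `ord_p [A : ℤP] = ord_p [A/T : ℤ·π(P)]` (both indices are Lean-`0` together when infinite).
* §2 (`E(K)`, `K` quadratic, `E[p]` irreducible): `E(K)[p] = 0` by `X11b.Transvection.
  torsion_eq_zero_of_irr` (`X11b/QuadraticTorsionOfIrr.lean`), `E(K)_tors` finite (Mordell–Weil,
  tree `finite_torsion_point`), so §1 applies: **`padicValNat_index_zmultiples_eq_modTorsion_of_irr`**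
  and the non-divisibility transfer `not_dvd_index_zmultiples_iff_modTorsion_of_irr`.
* §3 the consumer of S17 in the census currency: `indexLowerBoundAt_of_not_dvd_index_modTorsion`
  (STEP L at the datum from `p ∤ I_K`), `bsdp_of_heegnerIndexCertificate_modTorsion` (every odd `p`,
  atom A1 ∧ (ram): `ClassX11b W p`, `Ram W p`, `p ∤ ∏c`), and the `p = 3` rows
  `ClassX11b.bsdp_three_of_heegnerIndexCertificate_modTorsion`,
  **`IsX11Three.bsdp_of_heegnerIndexCertificate_modTorsion`** — S17's signatures VERBATIM with the
  certificate binder `hI : ¬ p ∣ (AddSubgroup.zmultiples (π P)).index` in place of the full index.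

An **A1 ∧ (ram) consumer**, exactly like S17: nothing is claimed on (T2′) cells or on the corner.
Certificate-shaped typed endpoint; whether an `L`-value/height-derived index certificate is
ADMISSIBLE as `hI` is referee A's question D-a″ (LEAD DEAL #6 R6-5); per pair; nothing booked; no
census read here; value contingent on D-a″ like S17 itself (typed hygiene otherwise).

References: [Miller2011LMS] §1, Def. 1.1 and §4 (index of the Heegner point modulo torsion);
[GrossZagier1986] V (2.1)–(2.2); [JetchevSkinnerWan2017] §7.4.1 (eq:shalowerK-1);
[SilvermanAEC2009] VIII.6–VIII.7 (Mordell–Weil, finiteness of torsion); [Serre1972] §2.8; cell files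
`X11b/Three/HeegnerIndexCertificate.lean`, `X11b/QuadraticTorsionOfIrr.lean`,
`X11b/BDPRouteRankOneBookkeeping.lean` (§1, the same index bookkeeping at a coordinate).
-/

noncomputable section

open scoped Classical

open WeierstrassCurve NumberField Literature.NumberTheory.EllipticCurves
  Literature.NumberTheory.EllipticCurves.ModularForms
  Literature.NumberTheory.EllipticCurves.Rank1Residual
  Literature.NumberTheory.EllipticCurves.Rank1Residual.Typed

namespace Summit.BirchSwinnertonDyer.Rank1Residual.X11b.Three

/-! ### §1. An additive group modulo its torsion: `[A : ℤP]` versus `[A/T : ℤ·π(P)]` -/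

section ModTorsion

variable {A : Type*} [AddCommGroup A] (P : A)

/-- `π⁻¹(ℤ·π(P)) = ℤP + T` for `π : A → A/T` the quotient by the torsion subgroup `T`
(`comap ∘ map = · ⊔ ker`). [folklore] -/
theorem comap_mk_zmultiples_mk_eq_sup_torsion :
    (AddSubgroup.zmultiples (QuotientAddGroup.mk' (AddCommGroup.torsion A) P)).comap
        (QuotientAddGroup.mk' (AddCommGroup.torsion A)) =
      AddSubgroup.zmultiples P ⊔ AddCommGroup.torsion A := by
  rw [← AddMonoidHom.map_zmultiples, AddSubgroup.comap_map_eq, QuotientAddGroup.ker_mk']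

/-- `[A : ℤP + T] = [A/T : ℤ·π(P)]` (`π` is onto). [folklore] -/
theorem index_zmultiples_sup_torsion_eq_index_mk :
    (AddSubgroup.zmultiples P ⊔ AddCommGroup.torsion A).index =
      (AddSubgroup.zmultiples (QuotientAddGroup.mk' (AddCommGroup.torsion A) P)).index := by
  rw [← comap_mk_zmultiples_mk_eq_sup_torsion,
    AddSubgroup.index_comap_of_surjective _ (QuotientAddGroup.mk'_surjective _)]

/-- **`[A : ℤP] = [ℤP + T : ℤP] · [A/T : ℤ·π(P)]`** for ANY `P` (no rank or order hypothesis; both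
sides are `0` when `[A : ℤP]` is infinite), with `[ℤP + T : ℤP] = [T : T ∩ ℤP]` written as the
relative index `(ℤP).relIndex T`. [folklore] -/
theorem index_zmultiples_eq_relIndex_mul_index_mk :
    (AddSubgroup.zmultiples P).index =
      (AddSubgroup.zmultiples P).relIndex (AddCommGroup.torsion A) *
        (AddSubgroup.zmultiples (QuotientAddGroup.mk' (AddCommGroup.torsion A) P)).index := by
  rw [← index_zmultiples_sup_torsion_eq_index_mk, ← AddSubgroup.relIndex_sup_left,
    AddSubgroup.relIndex_mul_index le_sup_left]

/-- `[A/T : ℤ·π(P)]` divides `[A : ℤP]`. [folklore] -/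
theorem index_mk_dvd_index_zmultiples :
    (AddSubgroup.zmultiples (QuotientAddGroup.mk' (AddCommGroup.torsion A) P)).index ∣
      (AddSubgroup.zmultiples P).index :=
  Dvd.intro_left _ (index_zmultiples_eq_relIndex_mul_index_mk P).symm

variable {p : ℕ}

/-- With `p ∤ #T` (`#T` as a `Nat.card`, so `T` finite): **`p ∣ [A : ℤP] ↔ p ∣ [A/T : ℤ·π(P)]`**
(the cofactor `[ℤP + T : ℤP]` divides `#T`). [folklore] -/
theorem dvd_index_zmultiples_iff_dvd_index_mk_of_not_dvd_card_torsion (hp : p.Prime)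
    (hT : ¬ p ∣ Nat.card (AddCommGroup.torsion A)) :
    p ∣ (AddSubgroup.zmultiples P).index ↔
      p ∣ (AddSubgroup.zmultiples (QuotientAddGroup.mk' (AddCommGroup.torsion A) P)).index := by
  refine ⟨fun h ↦ ?_, fun h ↦ h.trans (index_mk_dvd_index_zmultiples P)⟩
  rw [index_zmultiples_eq_relIndex_mul_index_mk] at h
  rcases hp.dvd_mul.mp h with h1 | h1
  · exact absurd (h1.trans (AddSubgroup.relIndex_dvd_card _ _)) hT
  · exact h1

variable [Finite (AddCommGroup.torsion A)]

/-- With `T` finite and `p ∤ #T`: **`ord_p [A : ℤP] = ord_p [A/T : ℤ·π(P)]`** for every `P`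
(when `[A/T : ℤ·π(P)] = 0`, i.e. the index is infinite, `[A : ℤP] = 0` too and both valuations are
`0`). [folklore] -/
theorem padicValNat_index_zmultiples_eq_modTorsion_of_not_dvd_card_torsion (hp : p.Prime)
    (hT : ¬ p ∣ Nat.card (AddCommGroup.torsion A)) :
    padicValNat p (AddSubgroup.zmultiples P).index =
      padicValNat p
        (AddSubgroup.zmultiples (QuotientAddGroup.mk' (AddCommGroup.torsion A) P)).index := by
  haveI : Fact p.Prime := ⟨hp⟩
  rw [index_zmultiples_eq_relIndex_mul_index_mk P]
  set r := (AddSubgroup.zmultiples P).relIndex (AddCommGroup.torsion A) with hr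
  set i := (AddSubgroup.zmultiples (QuotientAddGroup.mk' (AddCommGroup.torsion A) P)).index
  have hr0 : r ≠ 0 := AddSubgroup.FiniteIndex.index_ne_zero
  have hpr : padicValNat p r = 0 :=
    padicValNat.eq_zero_of_not_dvd fun h ↦ hT (h.trans (AddSubgroup.relIndex_dvd_card _ _))
  by_cases hi : i = 0
  · rw [hi, mul_zero]
  · rw [padicValNat.mul hr0 hi, hpr, zero_add]

variable [Fact p.Prime]

/-- No `p`-torsion ⟹ `p ∣ [A : ℤP] ↔ p ∣ [A/T : ℤ·π(P)]` (`p ∤ #T` by Cauchy,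
`LocalIndex.not_dvd_card_torsion`). [folklore] -/
theorem dvd_index_zmultiples_iff_dvd_index_mk (hiv : ∀ x : A, p • x = 0 → x = 0) :
    p ∣ (AddSubgroup.zmultiples P).index ↔
      p ∣ (AddSubgroup.zmultiples (QuotientAddGroup.mk' (AddCommGroup.torsion A) P)).index :=
  dvd_index_zmultiples_iff_dvd_index_mk_of_not_dvd_card_torsion P Fact.out
    (LocalIndex.not_dvd_card_torsion hiv)

/-- No `p`-torsion ⟹ **`ord_p [A : ℤP] = ord_p [A/T : ℤ·π(P)]`** for every `P`.
[cite: JetchevSkinnerWan2017, Prop. 3.2.1 and (7.1.5) (arXiv:1512.06894 pp. 10, 16), the index `[E(K):ℤP]_p`] -/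
theorem padicValNat_index_zmultiples_eq_modTorsion (hiv : ∀ x : A, p • x = 0 → x = 0) :
    padicValNat p (AddSubgroup.zmultiples P).index =
      padicValNat p
        (AddSubgroup.zmultiples (QuotientAddGroup.mk' (AddCommGroup.torsion A) P)).index :=
  padicValNat_index_zmultiples_eq_modTorsion_of_not_dvd_card_torsion P Fact.out
    (LocalIndex.not_dvd_card_torsion hiv)

end ModTorsion

/-! ### §2. `E(K)`, `K` quadratic, `E[p]` irreducible: the two index currencies agree `p`-adically -/

section Quadratic

variable (W : WeierstrassCurve ℚ) [W.IsElliptic] (p : ℕ) [Fact p.Prime]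
  (K : Type) [Field K] [NumberField K] (P : (W.baseChange K).toAffine.Point)

/-- **`ord_p [E(K) : ℤ·P] = ord_p [E(K)/E(K)_tors : ℤ·P̄]` on X11b's hypothesis `Irr W p` over a
quadratic field `K`, for EVERY `P ∈ E(K)`** (torsion or not, any rank): `E(K)[p] = 0`
(`X11b.Transvection.forall_torsion_eq_zero_of_irr`, Clifford for the index-two subgroup `Γ_K`), so
`p ∤ #E(K)_tors` (finite by Mordell–Weil), and §1 applies. `P̄ = QuotientAddGroup.mk' _ P` is the
image of `P` in the tree's `mordellWeilModTorsion (W.baseChange K)`; the right-hand index is the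
census's `I_K` when `P = P_K` is the Heegner point (Miller 2011 §4: heights see `E(K)/tors` only).
[cite: Miller2011LMS, §1 Def. 1.1 and §4] [cite: SilvermanAEC2009, §VIII.7 (p. 240)] [cite: Serre1972, §2.8] -/
theorem padicValNat_index_zmultiples_eq_modTorsion_of_irr (hirr : Irr W p)
    (hK : Module.finrank ℚ K = 2) :
    padicValNat p (AddSubgroup.zmultiples P).index =
      padicValNat p (AddSubgroup.zmultiples (QuotientAddGroup.mk'
        (AddCommGroup.torsion (W.baseChange K).toAffine.Point) P :
          mordellWeilModTorsion (W.baseChange K))).index := by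
  haveI : Finite (AddCommGroup.torsion (W.baseChange K).toAffine.Point) :=
    (W.baseChange K).finite_torsion_point
  exact padicValNat_index_zmultiples_eq_modTorsion P
    (Transvection.forall_torsion_eq_zero_of_irr W p hirr K hK)

/-- **`p ∤ [E(K) : ℤ·P] ↔ p ∤ [E(K)/E(K)_tors : ℤ·P̄]`** on `Irr W p` over a quadratic `K`, every
`P` — the certificate of S17 and the census-currency certificate are interchangeable (an infinite
index is `0`, divisible by `p`, on both sides at once). [cite: Miller2011LMS, §1 Def. 1.1 and §4]
[cite: Serre1972, §2.8] -/
theorem not_dvd_index_zmultiples_iff_modTorsion_of_irr (hirr : Irr W p)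
    (hK : Module.finrank ℚ K = 2) :
    ¬ p ∣ (AddSubgroup.zmultiples P).index ↔
      ¬ p ∣ (AddSubgroup.zmultiples (QuotientAddGroup.mk'
        (AddCommGroup.torsion (W.baseChange K).toAffine.Point) P :
          mordellWeilModTorsion (W.baseChange K))).index := by
  haveI : Finite (AddCommGroup.torsion (W.baseChange K).toAffine.Point) :=
    (W.baseChange K).finite_torsion_point
  exact not_congr (dvd_index_zmultiples_iff_dvd_index_mk P
    (Transvection.forall_torsion_eq_zero_of_irr W p hirr K hK))

end Quadratic

/-! ### §3. The S17 consumer in the census currency `p ∤ [E(K)/tors : ℤ·P̄_K]` -/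

section Consumer

/-- **`p ∤ [E(K)/E(K)_tors : ℤ·P̄]` ⇒ `IndexLowerBoundAt W p K P`** on `Irr W p` over a quadratic
`K` (every point `P`, no Heegner hypothesis): S17's `indexLowerBoundAt_of_not_dvd_index` with the
certificate in the census currency, transferred by `not_dvd_index_zmultiples_iff_modTorsion_of_irr`.
Bookkeeping. [cite: JetchevSkinnerWan2017, §7.4.1 (eq:shalowerK-1), p. 30] [cite: Miller2011LMS, §1 Def. 1.1 and §4] -/
theorem indexLowerBoundAt_of_not_dvd_index_modTorsion
    (W : WeierstrassCurve ℚ) [W.IsElliptic] (p : ℕ) [Fact p.Prime]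
    (K : Type) [Field K] [NumberField K] (P : (W.baseChange K).toAffine.Point)
    (hirr : Irr W p) (hK : Module.finrank ℚ K = 2)
    (hI : ¬ p ∣ (AddSubgroup.zmultiples (QuotientAddGroup.mk'
        (AddCommGroup.torsion (W.baseChange K).toAffine.Point) P :
          mordellWeilModTorsion (W.baseChange K))).index) :
    IndexLowerBoundAt W p K P :=
  indexLowerBoundAt_of_not_dvd_index W p K P
    ((not_dvd_index_zmultiples_iff_modTorsion_of_irr W p K P hirr hK).mpr hI)

/-- **X11b ∧ (ram) ∧ `p ∤ ∏c_ℓ`, EVERY ODD PRIME: `BSD(E,p)` from PUBLISHED theorems plus ONE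
Heegner-index CERTIFICATE IN THE CENSUS CURRENCY `p ∤ I_K = [E(K)/E(K)_tors : ℤ·P̄_K]` at ONE
Heegner datum with `d_K` odd** — S17's `bsdp_of_heegnerIndexCertificate` (binders VERBATIM: `Dt` a
modular parametrisation of level `N_E`, `K` imaginary quadratic with ODD `d_K` and the Heegner
hypothesis for `N_E`, `P ∈ E(K)` mapping to `heegnerPointComplex Dt H` under `ι`, `p ∤ c(Dt)`,
`p ∤ #𝓞_K^×`, `L(E^{d_K},1) ≠ 0`, `Wd` a minimal model of the twist; published inputs Gross–Zagier,
Kolyvagin + Thm. A / McCallum's bound, Skinner 2016 Thm. C, GZK, modularity) with the certificate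
moved to `E(K)/tors` by §2 (`Irr W p` is in `ClassX11b`, `[K:ℚ] = 2` in `IsImaginaryQuadratic`).
An **A1 ∧ (ram) consumer** — nothing claimed on (T2′) cells or the corner. Certificate-shaped
typed endpoint; admissibility of an index certificate as `hI` = referee A's D-a″ (LEAD DEAL #6
R6-5); per pair; nothing booked; no census read here. [cite: JetchevSkinnerWan2017, §7.4.1–7.4.2 (pp. 30–31)]
[cite: GrossLMS1991, §1 Thm. 1.3 and (2.1)–(2.3)] [cite: McCallumLMS1991, §1 Theorem (Kolyvagin), p. 296]
[cite: Skinner2016PacificMC, Thm. C (§1) and footnote 1] [cite: Mazur1978, Cor. 4.1]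
[cite: Miller2011LMS, §1 Def. 1.1 and §4] -/
theorem bsdp_of_heegnerIndexCertificate_modTorsion
    (W : WeierstrassCurve ℚ) [W.IsElliptic] [W.IsGloballyMinimal] (p : ℕ) [Fact p.Prime]
    [NeZero (W.conductorNorm ℤ)] (K : Type) [Field K] [NumberField K]
    (Dt : ModularParametrizationData W (W.conductorNorm ℤ))
    (H : HeegnerDatum (W.conductorNorm ℤ) (NumberField.discr K)) (ι : K →+* ℂ)
    (P : (W.baseChange K).toAffine.Point)
    -- the published inputs (named facts of the tree)
    (hGZ : gross_zagier (W.conductorNorm ℤ) W K) (hKo : kolyvagin (W.conductorNorm ℤ) W K)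
    (hB : Kolyvagin1990_padicValNat_card_sha_le (W.conductorNorm ℤ) W K)
    (hSk : Skinner2016.thmC_padicValRat_bsd_rank_zero)
    (hGZK : rank_eq_analyticRank_of_analyticRank_le_one) (hmod : hasEntireLFunction_rat)
    -- the pair, on the atom A1 ∧ (ram)
    (hX : ClassX11b W p) (hram : Ram W p) (htam0 : ¬ p ∣ W.tamagawaProduct)
    -- ONE Heegner datum with `d_K` odd
    (hK : IsImaginaryQuadratic K) (hodd : Odd (NumberField.discr K))
    (hHN : SatisfiesHeegnerHypothesis (W.conductorNorm ℤ) K)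
    (hP : WeierstrassCurve.Affine.Point.map ι.toRatAlgHom P = heegnerPointComplex Dt H)
    (hc : ¬ (p : ℤ) ∣ Dt.c) (hμ : ¬ p ∣ Units.torsionOrder K)
    (hLt : (W.quadraticTwist (NumberField.discr K : ℚ)).entireLFunction 1 ≠ 0)
    (Wd : WeierstrassCurve ℚ) [Wd.IsElliptic] [Wd.IsGloballyMinimal] (Cd : VariableChange ℚ)
    (hWd : Cd • W.quadraticTwist (NumberField.discr K : ℚ) = Wd)
    -- the CERTIFICATE in the census currency: `p ∤ [E(K)/E(K)_tors : ℤ·P̄]`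
    (hI : ¬ p ∣ (AddSubgroup.zmultiples (QuotientAddGroup.mk'
        (AddCommGroup.torsion (W.baseChange K).toAffine.Point) P :
          mordellWeilModTorsion (W.baseChange K))).index) : BSDp W p :=
  bsdp_of_heegnerIndexCertificate W p K Dt H ι P hGZ hKo hB hSk hGZK hmod hX hram htam0 hK hodd hHN hP
    hc hμ hLt Wd Cd hWd
    ((not_dvd_index_zmultiples_iff_modTorsion_of_irr W p K P hX.2.2.2 hK.1).mpr hI)

/-- **X11b@3 ∧ (ram) ∧ `3 ∤ ∏c_ℓ` (`ClassX11b W 3`): ONE odd Heegner datum with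
`3 ∤ I_K = [E(K)/E(K)_tors : ℤ·P̄_K]` ⇒ `BSD(E,3)`** — S17's
`ClassX11b.bsdp_three_of_heegnerIndexCertificate` (`3 ∤ #𝓞_K^×` discharged there) with the
certificate in the census currency. Certificate-shaped; admissibility = referee A's D-a″; per pair;
X11 ∧ `r = 1` ∧ `p = 3` stays CONSTRUCTION-SHAPED (R6.2); nothing booked.
[cite: JetchevSkinnerWan2017, §7.4.1–7.4.2 (pp. 30–31)] [cite: McCallumLMS1991, §1 Theorem (Kolyvagin), p. 296]
[cite: Skinner2016PacificMC, Thm. C (§1) and footnote 1] [cite: Miller2011LMS, §1 Def. 1.1 and §4] -/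
theorem ClassX11b.bsdp_three_of_heegnerIndexCertificate_modTorsion [Fact (Nat.Prime 3)]
    (W : WeierstrassCurve ℚ) [W.IsElliptic] [W.IsGloballyMinimal]
    [NeZero (W.conductorNorm ℤ)] (K : Type) [Field K] [NumberField K]
    (Dt : ModularParametrizationData W (W.conductorNorm ℤ))
    (H : HeegnerDatum (W.conductorNorm ℤ) (NumberField.discr K)) (ι : K →+* ℂ)
    (P : (W.baseChange K).toAffine.Point)
    (hGZ : gross_zagier (W.conductorNorm ℤ) W K) (hKo : kolyvagin (W.conductorNorm ℤ) W K)
    (hB : Kolyvagin1990_padicValNat_card_sha_le (W.conductorNorm ℤ) W K)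
    (hSk : Skinner2016.thmC_padicValRat_bsd_rank_zero)
    (hGZK : rank_eq_analyticRank_of_analyticRank_le_one) (hmod : hasEntireLFunction_rat)
    (hX : ClassX11b W 3) (hram : Ram W 3) (htam0 : ¬ 3 ∣ W.tamagawaProduct)
    (hK : IsImaginaryQuadratic K) (hodd : Odd (NumberField.discr K))
    (hHN : SatisfiesHeegnerHypothesis (W.conductorNorm ℤ) K)
    (hP : WeierstrassCurve.Affine.Point.map ι.toRatAlgHom P = heegnerPointComplex Dt H)
    (hc : ¬ (3 : ℤ) ∣ Dt.c)
    (hLt : (W.quadraticTwist (NumberField.discr K : ℚ)).entireLFunction 1 ≠ 0)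
    (Wd : WeierstrassCurve ℚ) [Wd.IsElliptic] [Wd.IsGloballyMinimal] (Cd : VariableChange ℚ)
    (hWd : Cd • W.quadraticTwist (NumberField.discr K : ℚ) = Wd)
    (hI : ¬ 3 ∣ (AddSubgroup.zmultiples (QuotientAddGroup.mk'
        (AddCommGroup.torsion (W.baseChange K).toAffine.Point) P :
          mordellWeilModTorsion (W.baseChange K))).index) : BSDp W 3 :=
  ClassX11b.bsdp_three_of_heegnerIndexCertificate W K Dt H ι P hGZ hKo hB hSk hGZK hmod hX hram htam0
    hK hodd hHN hP hc hLt Wd Cd hWd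
    ((not_dvd_index_zmultiples_iff_modTorsion_of_irr W 3 K P hX.2.2.2 hK.1).mpr hI)

/-- **The same in the vocabulary of `IsX11Three`** (`mult(3) ∧ irr(3) ∧ r_an = 1`,
`Rank1Residual/X11Three.lean`): ONE odd Heegner datum on an A1 ∧ (ram) pair with
`3 ∤ I_K = [E(K)/E(K)_tors : ℤ·P̄_K]` (the census currency) ⇒ `BSD(E,3)`. Certificate-shaped
typed endpoint (police row H29 typed); per pair; nothing booked.
[cite: JetchevSkinnerWan2017, §7.4.1–7.4.2 (pp. 30–31)] [cite: Skinner2016PacificMC, Thm. C (§1) and footnote 1]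
[cite: Miller2011LMS, §1 Def. 1.1 and §4] -/
theorem IsX11Three.bsdp_of_heegnerIndexCertificate_modTorsion [Fact (Nat.Prime 3)]
    (W : WeierstrassCurve ℚ) [W.IsElliptic] [W.IsGloballyMinimal]
    [NeZero (W.conductorNorm ℤ)] (K : Type) [Field K] [NumberField K]
    (Dt : ModularParametrizationData W (W.conductorNorm ℤ))
    (H : HeegnerDatum (W.conductorNorm ℤ) (NumberField.discr K)) (ι : K →+* ℂ)
    (P : (W.baseChange K).toAffine.Point)
    (hGZ : gross_zagier (W.conductorNorm ℤ) W K) (hKo : kolyvagin (W.conductorNorm ℤ) W K)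
    (hB : Kolyvagin1990_padicValNat_card_sha_le (W.conductorNorm ℤ) W K)
    (hSk : Skinner2016.thmC_padicValRat_bsd_rank_zero)
    (hGZK : rank_eq_analyticRank_of_analyticRank_le_one) (hmod : hasEntireLFunction_rat)
    (hX : IsX11Three W) (hram : Ram W 3) (htam0 : ¬ 3 ∣ W.tamagawaProduct)
    (hK : IsImaginaryQuadratic K) (hodd : Odd (NumberField.discr K))
    (hHN : SatisfiesHeegnerHypothesis (W.conductorNorm ℤ) K)
    (hP : WeierstrassCurve.Affine.Point.map ι.toRatAlgHom P = heegnerPointComplex Dt H)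
    (hc : ¬ (3 : ℤ) ∣ Dt.c)
    (hLt : (W.quadraticTwist (NumberField.discr K : ℚ)).entireLFunction 1 ≠ 0)
    (Wd : WeierstrassCurve ℚ) [Wd.IsElliptic] [Wd.IsGloballyMinimal] (Cd : VariableChange ℚ)
    (hWd : Cd • W.quadraticTwist (NumberField.discr K : ℚ) = Wd)
    (hI : ¬ 3 ∣ (AddSubgroup.zmultiples (QuotientAddGroup.mk'
        (AddCommGroup.torsion (W.baseChange K).toAffine.Point) P :
          mordellWeilModTorsion (W.baseChange K))).index) : BSDp W 3 :=
  ClassX11b.bsdp_three_of_heegnerIndexCertificate_modTorsion W K Dt H ι P hGZ hKo hB hSk hGZK hmod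
    (classX11b_three_of_isX11Three W hX) hram htam0 hK hodd hHN hP hc hLt Wd Cd hWd hI

end Consumer

end Summit.BirchSwinnertonDyer.Rank1Residual.X11b.Three

end
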